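import Summits.RiemannHypothesis.RiemannHypothesis.Theorems.Splittings.JensenWindowDeGuaCount
import Literature.Analysis.Complex.RoucheTheorem
import Literature.NumberTheory.LFunctions.LogDerivRectangleResidues
import Summits.RiemannHypothesis.RiemannHypothesis.Theorems.UniversalFactorLaplaceLoopholeInterlacing

/-!
# TiltedLandingLaw421R3 — lens-1 (O6-a, director-rh g24): the ARC-SIGN census on a Jensen CIRCLE — part A (general pieces)

LENS-1 gen-6 module image `rh33346-cover/lens-1/ArcSignA-v2.lean` (v2 = v1 citing the treeʼs `EntireEF.analyticOrderAt_ne_top_of_entire` and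
`UniversalFactor.im_logDeriv_ofReal` instead of restating them; landing target `…/Theorems/TiltedLandingLaw421R3Lens1ArcSignA.lean`;
imports the tree's `…Splittings.JensenWindowDeGuaCount` (`zeroCountC`, `sgn`, `SWindow`, `RolleIdentity`, `LocalB`, `order_pos`,
`rolleIdentity_of_localB_core`, `log_negI_mul_sub_log_I_mul`) and `Literature.Analysis.Complex.RoucheTheorem` (argument principle on a
circle with the divisor kept: `Rouche.wind_circleLoop_eq_finsum_divisor`, `Rouche.finsum_divisor_eq_finsum_mem_analyticOrderNatAt`);
namespace `RhW08.Lens1ArcSign`; 0 `sorry`, no instances / notation, nothing inlined).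

THE LENS (arc-sign pinning, `Cruxes/TiltedLandingLaw421R/Ideas/arc-sign-pinning.md`): Walsh's two-circle count done on `a`'s OWN Jensen
circle `|w − Re a| = Im a + δ` instead of a square window.  Part A is the hypothesis-free complex analysis, reusable by every rung:

§1 ★ `log_increment_eq` — THE ARC LEMMA («`G′/G` in one open half-plane along an arc ⇒ `|Δ arg| ≤ π`», in exact form): along an arc on
   which the ROTATED path `c·Γ` (`c ≠ 0`, typically `c = ±i`) avoids the cut `(−∞,0]`, EVERY continuous logarithm of `Γ` has increment
   `log (c Γ(t₂)) − log (c Γ(t₁))` (uniqueness of logarithms on an interval, `Literature…exists_int_eq_add_of_exp_eq`).  For `c = i` the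
   hypothesis reads «`Γ` never meets the closed positive imaginary axis» (in particular: `Im Γ < 0` inside, real non-zero ends).
§2 ★ `two_mul_wind_eq` — TWO-HALF-PLANE LOOP LEMMA: a loop on `[0,1]` whose first half avoids `i·[0,∞)` and whose second half avoids
   `−i·[0,∞)`, real at `t = 0, ½`, has `2·wind Γ = sgn Re Γ(½) − sgn Re Γ(0)` (so `wind Γ ∈ {0, ±1}`: the `m̃ = 0` case of the lens's `k`).
§3 circle-loop geometry over a real centre (`Im`, the two feet `t = 0 ↦ c + r`, `t = ½ ↦ c − r`, real points of the circle = the feet).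
§4 ★ `wind_circleLoop_eq_zeroCountC` — the argument principle in the tree's CENSUS CURRENCY: for an entire `g` zero-free on the circle,
   `wind (g ∘ circleLoop c r) = zeroCountC g (ball c r)` (orders identified through `analyticOrderNatAt`, not hidden behind `∃`).
§5 ★★ `disc_census` — KIM–WALSH CENSUS ON A DISC: `f` entire and real, `f, f′ ≠ 0` at the feet `c ± r`, and the Jensen–Nagy sign
   `Im w · Im (f′/f)(w) < 0` at every non-real point of the circle ⇒ `2 (N_D(f′) − N_D(f)) = sgn (f′/f)(c − r) − sgn (f′/f)(c + r)`
   (the disc twin of `…JensenWindow.census_core`, whose square needs Jensen-clear SIDES — the obstruction on the crossing population).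
§6 ★ `no_nonreal_zero_of_disc` — disc Rolle closure (twin of `…JensenWindow.no_nonreal_zero_of_rolle_core`): the census, «every zero of
   `f′` in the disc is real» and the real Rolle identity on the base force every zero of `f` in the disc to be real.

HONEST LABEL: tools only; `TopPinning` / `TopPinningCrossing` / `RegUmbrella11S` / 33346 / 33347 stay OPEN; nothing here bears on the truth
of RH; RH is not proved; checked ≠ proved.
-/

noncomputable section

namespace RhW08.Lens1ArcSign

open Complex Set Metric
open scoped Real
open Literature.Topology.PlaneTopology Literature.Analysis.Complex
open Summit.RiemannHypothesis.RiemannHypothesis.Theorems.Splittings.JensenWindow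

variable {f : ℂ → ℂ}

/-! ## §1 The arc lemma: log increments along an arc whose rotate avoids the cut -/

/-- ★ ARC LEMMA.  If `c ≠ 0` and `c · Γ t ∉ (−∞,0]` for `t ∈ [t₁,t₂]`, every continuous logarithm `l` of `Γ` on `[t₁,t₂]` has increment
`l t₂ − l t₁ = log (c Γ t₂) − log (c Γ t₁)`; with `c = i` (`Γ` off the closed positive imaginary axis, e.g. `Im Γ < 0` inside and real
non-zero ends) resp. `c = −i` this is the exact form of «`|Δ arg Γ| ≤ π` along an arc kept in one half-plane». -/
theorem log_increment_eq {Γ l : ℝ → ℂ} {t₁ t₂ : ℝ} (ht : t₁ ≤ t₂) (hΓ : ContinuousOn Γ (Icc t₁ t₂))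
    (hl : ContinuousOn l (Icc t₁ t₂)) (hexp : ∀ t ∈ Icc t₁ t₂, exp (l t) = Γ t) {c : ℂ} (hc : c ≠ 0)
    (hcut : ∀ t ∈ Icc t₁ t₂, c * Γ t ∈ slitPlane) :
    l t₂ - l t₁ = log (c * Γ t₂) - log (c * Γ t₁) := by
  have hm : ContinuousOn (fun t => log (c * Γ t) - log c) (Icc t₁ t₂) :=
    ((continuousOn_const.mul hΓ).clog hcut).sub continuousOn_const
  have hme : ∀ t ∈ Icc t₁ t₂, exp (l t) = exp (log (c * Γ t) - log c) := by
    intro t ht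
    rw [hexp t ht, exp_sub, exp_log (slitPlane_ne_zero (hcut t ht)), exp_log hc, mul_div_cancel_left₀ _ hc]
  obtain ⟨n, hn⟩ := exists_int_eq_add_of_exp_eq isPreconnected_Icc hl hm hme
  rw [hn t₂ (right_mem_Icc.2 ht), hn t₁ (left_mem_Icc.2 ht)]
  ring

/-! ## §2 The two-half-plane loop lemma (`m̃ = 0`) -/

/-- ★ TWO-HALF-PLANE LOOP LEMMA.  A loop `Γ` on `[0,1]` with `i Γ ∉ (−∞,0]` on `[0,½]`, `−i Γ ∉ (−∞,0]` on `[½,1]`, real at `t = 0` and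
`t = ½`, winds `wind Γ = (sgn Re Γ(½) − sgn Re Γ(0)) / 2` times about `0`. -/
theorem two_mul_wind_eq {Γ : ℝ → ℂ} (hΓ : ContinuousOn Γ (Icc 0 1)) (h01 : Γ 0 = Γ 1)
    (hlo : ∀ t ∈ Icc (0 : ℝ) (1 / 2), I * Γ t ∈ slitPlane) (hhi : ∀ t ∈ Icc (1 / 2 : ℝ) 1, -I * Γ t ∈ slitPlane)
    (h0 : (Γ 0).im = 0) (hh : (Γ (1 / 2)).im = 0) :
    2 * (wind Γ : ℂ) = sgn (Γ (1 / 2)).re - sgn (Γ 0).re := by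
  have hne : ∀ t ∈ Icc (0 : ℝ) 1, Γ t ≠ 0 := by
    intro t ht h0t
    by_cases h : t ≤ 1 / 2
    · exact slitPlane_ne_zero (hlo t ⟨ht.1, h⟩) (by rw [h0t, mul_zero])
    · exact slitPlane_ne_zero (hhi t ⟨(not_le.mp h).le, ht.2⟩) (by rw [h0t, mul_zero])
  obtain ⟨l, hl, hle⟩ := (IsNonvanishingLoop.mk hΓ hne h01).hasLogOn
  have hw := wind_spec hl hle h01
  have hq0 : (0 : ℝ) ≤ 1 / 2 := by norm_num
  have hq1 : (1 / 2 : ℝ) ≤ 1 := by norm_num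
  have e1 := log_increment_eq hq0 (hΓ.mono (Icc_subset_Icc_right hq1)) (hl.mono (Icc_subset_Icc_right hq1))
    (fun t ht => hle t ⟨ht.1, ht.2.trans hq1⟩) I_ne_zero hlo
  have e2 := log_increment_eq hq1 (hΓ.mono (Icc_subset_Icc_left hq0)) (hl.mono (Icc_subset_Icc_left hq0))
    (fun t ht => hle t ⟨hq0.trans ht.1, ht.2⟩) (neg_ne_zero.2 I_ne_zero) hhi
  have hΓ0 : Γ 0 = ((Γ 0).re : ℂ) := Complex.ext (by rw [ofReal_re]) (by rw [ofReal_im, h0])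
  have hΓ1 : Γ 1 = ((Γ 0).re : ℂ) := by rw [← h01]; exact hΓ0
  have hΓh : Γ (1 / 2) = ((Γ (1 / 2)).re : ℂ) := Complex.ext (by rw [ofReal_re]) (by rw [ofReal_im, hh])
  have hx0 : (Γ 0).re ≠ 0 := fun h => hne 0 ⟨le_rfl, zero_le_one⟩ (by rw [hΓ0, h, ofReal_zero])
  have hxh : (Γ (1 / 2)).re ≠ 0 := fun h => hne (1 / 2) ⟨hq0, hq1⟩ (by rw [hΓh, h, ofReal_zero])
  have k0 := log_negI_mul_sub_log_I_mul hx0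
  have kh := log_negI_mul_sub_log_I_mul hxh
  have htot : l 1 - l 0 = (l 1 - l (1 / 2)) + (l (1 / 2) - l 0) := by ring
  rw [htot, e1, e2, hΓ1, hΓh, hΓ0] at hw
  simp only [ofReal_re] at hw
  have key : (wind Γ : ℂ) * (2 * π * I) = (Real.pi * I) * (sgn (Γ (1 / 2)).re - sgn (Γ 0).re) := by
    rw [← hw]
    linear_combination k0 - kh
  have hπI : (Real.pi : ℂ) * I ≠ 0 := mul_ne_zero (ofReal_ne_zero.2 Real.pi_ne_zero) I_ne_zero
  apply mul_right_cancel₀ hπI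
  linear_combination key

/-! ## §3 Circle-loop geometry over a real centre -/

/-- `Im` along the circle loop of real centre `c`: `r sin 2πt`. -/
theorem circleLoop_ofReal_im (c r t : ℝ) : (circleLoop (c : ℂ) r t).im = r * Real.sin (2 * π * t) := by
  have e : (2 * ↑π * ↑t * I : ℂ) = ((2 * π * t : ℝ) : ℂ) * I := by push_cast; ring
  rw [circleLoop_apply, e, add_im, ofReal_im, im_ofReal_mul, exp_ofReal_mul_I_im, zero_add]

/-- The right foot: `t = 0 ↦ c + r`. -/
theorem circleLoop_ofReal_zero (c r : ℝ) : circleLoop (c : ℂ) r 0 = ((c + r : ℝ) : ℂ) := by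
  rw [circleLoop_apply]; push_cast; simp

/-- The left foot: `t = ½ ↦ c − r`. -/
theorem circleLoop_ofReal_half (c r : ℝ) : circleLoop (c : ℂ) r (1 / 2) = ((c - r : ℝ) : ℂ) := by
  have e : (2 * ↑π * ↑((1 : ℝ) / 2) * I : ℂ) = ↑π * I := by push_cast; ring
  rw [circleLoop_apply, e, Complex.exp_pi_mul_I]; push_cast; ring

/-- On the upper closed half-loop `t ∈ [0,½]` the imaginary part is `≥ 0` (`r ≥ 0`). -/
theorem circleLoop_im_nonneg {c r : ℝ} (hr : 0 ≤ r) {t : ℝ} (ht : t ∈ Icc (0 : ℝ) (1 / 2)) : 0 ≤ (circleLoop (c : ℂ) r t).im := by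
  rw [circleLoop_ofReal_im]
  exact mul_nonneg hr (Real.sin_nonneg_of_nonneg_of_le_pi (by nlinarith [Real.pi_pos, ht.1]) (by nlinarith [Real.pi_pos, ht.2]))

/-- On the lower closed half-loop `t ∈ [½,1]` the imaginary part is `≤ 0` (`r ≥ 0`). -/
theorem circleLoop_im_nonpos {c r : ℝ} (hr : 0 ≤ r) {t : ℝ} (ht : t ∈ Icc (1 / 2 : ℝ) 1) : (circleLoop (c : ℂ) r t).im ≤ 0 := by
  rw [circleLoop_ofReal_im, ← Real.sin_sub_two_pi]
  exact mul_nonpos_of_nonneg_of_nonpos hr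
    (Real.sin_nonpos_of_nonpos_of_neg_pi_le (by nlinarith [Real.pi_pos, ht.2]) (by nlinarith [Real.pi_pos, ht.1]))

/-- The real points of the circle `‖u − c‖ = r` (`c` real) are its two feet `c ± r`. -/
theorem eq_feet_of_sphere_real {c r : ℝ} {u : ℂ} (hu : ‖u - c‖ = r) (him : u.im = 0) :
    u = ((c + r : ℝ) : ℂ) ∨ u = ((c - r : ℝ) : ℂ) := by
  have e : u = ((u.re : ℝ) : ℂ) := Complex.ext (by simp) (by simp [him])
  rw [e, ← ofReal_sub, Complex.norm_real, Real.norm_eq_abs] at hu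
  have hr : 0 ≤ r := hu ▸ abs_nonneg _
  rcases (abs_eq hr).mp hu with h | h
  · left; rw [e, show u.re = c + r by linarith]
  · right; rw [e, show u.re = c - r by linarith]

/-- The open disc of real centre lies in the square box of the same centre and radius. -/
theorem ball_subset_box (c r : ℝ) : ball (c : ℂ) r ⊆ Ioo (c - r) (c + r) ×ℂ Ioo (-r) r := by
  intro z hz
  rw [mem_ball, dist_eq_norm] at hz
  have h1 := lt_of_le_of_lt (abs_re_le_norm (z - c)) hz
  have h2 := lt_of_le_of_lt (abs_im_le_norm (z - c)) hz
  rw [sub_re, ofReal_re, abs_lt] at h1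
  rw [sub_im, ofReal_im, sub_zero, abs_lt] at h2
  exact mem_reProdIm.2 ⟨⟨by linarith [h1.1], by linarith [h1.2]⟩, ⟨h2.1, h2.2⟩⟩

/-- A real point of the box `(c − r, c + r) × (−r, r)` lies in the disc. -/
theorem mem_ball_of_box_real {c r : ℝ} {ρ : ℂ} (hρ : ρ ∈ Ioo (c - r) (c + r) ×ℂ Ioo (-r) r) (him : ρ.im = 0) :
    ρ ∈ ball (c : ℂ) r := by
  have e : ρ - c = (((ρ.re - c : ℝ)) : ℂ) := Complex.ext (by simp) (by simp [him])
  have h := (mem_reProdIm.mp hρ).1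
  rw [mem_ball, dist_eq_norm, e, Complex.norm_real, Real.norm_eq_abs, abs_lt]
  exact ⟨by linarith [h.1], by linarith [h.2]⟩

/-- Real-axis counts agree: box ∩ ℝ and disc ∩ ℝ carry the same zeros. -/
theorem zeroCountC_box_real_eq (g : ℂ → ℂ) (c r : ℝ) :
    zeroCountC g ((Ioo (c - r) (c + r) ×ℂ Ioo (-r) r) ∩ {ρ | ρ.im = 0}) = zeroCountC g (ball (c : ℂ) r ∩ {ρ | ρ.im = 0}) := by
  have hset : {ρ : ℂ | g ρ = 0 ∧ ρ ∈ (Ioo (c - r) (c + r) ×ℂ Ioo (-r) r) ∩ {ρ | ρ.im = 0}} =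
      {ρ : ℂ | g ρ = 0 ∧ ρ ∈ ball (c : ℂ) r ∩ {ρ | ρ.im = 0}} := by
    ext ρ
    simp only [mem_setOf_eq, mem_inter_iff]
    constructor
    · rintro ⟨h0, hb, him⟩; exact ⟨h0, mem_ball_of_box_real hb him, him⟩
    · rintro ⟨h0, hb, him⟩; exact ⟨h0, ball_subset_box c r hb, him⟩
  unfold zeroCountC
  rw [hset]

/-! ## §4 The argument principle in census currency -/

/-- ★ ARGUMENT PRINCIPLE IN CENSUS CURRENCY: for an entire `g` zero-free on the circle `‖u − c‖ = r` (`r > 0`), the winding number of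
`g ∘ circleLoop c r` about `0` is the tree's count `zeroCountC g (ball c r)` of the zeros inside, with multiplicity.
[Conway, Functions of One Complex Variable I, Ch. V §3 Thm 3.4, via `Literature…Rouche.wind_circleLoop_eq_finsum_divisor`.] -/
theorem wind_circleLoop_eq_zeroCountC {g : ℂ → ℂ} (hg : Differentiable ℂ g) {c : ℂ} {r : ℝ} (hr : 0 < r)
    (hsph : ∀ u : ℂ, ‖u - c‖ = r → g u ≠ 0) :
    ((wind (fun t => g (circleLoop c r t)) : ℤ) : ℂ) = zeroCountC g (ball c r) := by
  classical
  have hrρ : r < r + 1 := by linarith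
  have hgd : DifferentiableOn ℂ g (ball c (r + 1)) := hg.differentiableOn
  rw [Rouche.wind_circleLoop_eq_finsum_divisor g hr hrρ hgd hsph,
    Rouche.finsum_divisor_eq_finsum_mem_analyticOrderNatAt g hr hrρ hgd hsph]
  have hcr : ‖c + (r : ℂ) - c‖ = r := by rw [add_sub_cancel_left, Complex.norm_of_nonneg hr.le]
  have hne_top : ∀ z, analyticOrderAt g z ≠ ⊤ :=
    Literature.NumberTheory.LFunctions.EntireEF.analyticOrderAt_ne_top_of_entire hg (hsph _ hcr)
  set Z : Set ℂ := {ρ : ℂ | g ρ = 0 ∧ ρ ∈ ball c r} with hZ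
  have hZfin : Z.Finite := by
    refine (Rouche.finite_zeros g hr hrρ hgd hsph).subset ?_
    rintro ρ ⟨h0, hρ⟩
    exact ⟨ball_subset_closedBall hρ, h0⟩
  have hset : ball c r ∩ Function.support (analyticOrderNatAt g) = Z ∩ Function.support (analyticOrderNatAt g) := by
    ext z
    simp only [mem_inter_iff, Function.mem_support, hZ, mem_setOf_eq]
    constructor
    · rintro ⟨hb, hs⟩; exact ⟨⟨apply_eq_zero_of_analyticOrderNatAt_ne_zero hs, hb⟩, hs⟩
    · rintro ⟨⟨-, hb⟩, hs⟩; exact ⟨hb, hs⟩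
  rw [finsum_mem_inter_support_eq _ _ _ hset, finsum_mem_eq_finite_toFinset_sum _ hZfin]
  unfold zeroCountC
  rw [finsum_mem_eq_finite_toFinset_sum _ hZfin]
  push_cast
  refine Finset.sum_congr rfl fun z _ => ?_
  have hn : analyticOrderAt g z = (analyticOrderNatAt g z : ℕ∞) := (Nat.cast_analyticOrderNatAt (hne_top z)).symm
  rw [(hg.analyticAt z).meromorphicOrderAt_eq, hn]
  simp

/-! ## §5 The Kim–Walsh census on a disc -/

/-- Under the circle sign hypothesis and non-vanishing at the feet, `f` has no zero on the circle. -/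
theorem ne_zero_on_sphere {c r : ℝ} (hfl : f ((c - r : ℝ) : ℂ) ≠ 0) (hfr : f ((c + r : ℝ) : ℂ) ≠ 0)
    (hsgn : ∀ w : ℂ, ‖w - c‖ = r → w.im ≠ 0 → w.im * (deriv f w / f w).im < 0) :
    ∀ u : ℂ, ‖u - c‖ = r → f u ≠ 0 := by
  intro u hu h0
  by_cases him : u.im = 0
  · rcases eq_feet_of_sphere_real hu him with e | e
    · exact hfr (e ▸ h0)
    · exact hfl (e ▸ h0)
  · have h := hsgn u hu him
    rw [h0, div_zero, Complex.zero_im, mul_zero] at h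
    exact lt_irrefl _ h

/-- Under the circle sign hypothesis and non-vanishing at the feet, `f′` has no zero on the circle. -/
theorem deriv_ne_zero_on_sphere {c r : ℝ} (hdl : deriv f ((c - r : ℝ) : ℂ) ≠ 0) (hdr : deriv f ((c + r : ℝ) : ℂ) ≠ 0)
    (hsgn : ∀ w : ℂ, ‖w - c‖ = r → w.im ≠ 0 → w.im * (deriv f w / f w).im < 0) :
    ∀ u : ℂ, ‖u - c‖ = r → deriv f u ≠ 0 := by
  intro u hu h0
  by_cases him : u.im = 0
  · rcases eq_feet_of_sphere_real hu him with e | e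
    · exact hdr (e ▸ h0)
    · exact hdl (e ▸ h0)
  · have h := hsgn u hu him
    rw [h0, zero_div, Complex.zero_im, mul_zero] at h
    exact lt_irrefl _ h

/-- ★★ KIM–WALSH CENSUS ON A DISC.  `f` entire and real, `f, f′ ≠ 0` at the feet `c ± r` (`r > 0`), and `Im w · Im (f′/f)(w) < 0` at every
non-real point of the circle `‖w − c‖ = r` ⇒ `2 (N_D(f′) − N_D(f)) = sgn (f′/f)(c − r) − sgn (f′/f)(c + r)` on the open disc `D`.
[Walsh, Ann. of Math. 22 (1920) §4; Kim, PAMS 124 (1996) Thm 1 — window form in the tree: `…JensenWindow.census_core`.] -/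
theorem disc_census (hfd : Differentiable ℂ f) (hreal : ∀ x : ℝ, (f x).im = 0) {c r : ℝ} (hr : 0 < r)
    (hfl : f ((c - r : ℝ) : ℂ) ≠ 0) (hfr : f ((c + r : ℝ) : ℂ) ≠ 0)
    (hdl : deriv f ((c - r : ℝ) : ℂ) ≠ 0) (hdr : deriv f ((c + r : ℝ) : ℂ) ≠ 0)
    (hsgn : ∀ w : ℂ, ‖w - c‖ = r → w.im ≠ 0 → w.im * (deriv f w / f w).im < 0) :
    2 * (zeroCountC (deriv f) (ball (c : ℂ) r) - zeroCountC f (ball (c : ℂ) r)) =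
      sgn (deriv f ((c - r : ℝ) : ℂ) / f ((c - r : ℝ) : ℂ)).re - sgn (deriv f ((c + r : ℝ) : ℂ) / f ((c + r : ℝ) : ℂ)).re := by
  have hf0 := ne_zero_on_sphere hfl hfr hsgn
  have hd0 := deriv_ne_zero_on_sphere hdl hdr hsgn
  have hγr : ∀ t : ℝ, ‖circleLoop (c : ℂ) r t - c‖ = r := fun t => by rw [norm_circleLoop_sub_center, abs_of_pos hr]
  have hcf : Continuous fun t : ℝ => f (circleLoop (c : ℂ) r t) := hfd.continuous.comp (continuous_circleLoop _ _)
  have hcd : Continuous fun t : ℝ => deriv f (circleLoop (c : ℂ) r t) := hfd.deriv.continuous.comp (continuous_circleLoop _ _)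
  have hF : IsNonvanishingLoop (fun t => f (circleLoop (c : ℂ) r t)) :=
    ⟨hcf.continuousOn, fun t _ => hf0 _ (hγr t), by simp only [circleLoop_zero_eq]⟩
  have hF' : IsNonvanishingLoop (fun t => deriv f (circleLoop (c : ℂ) r t)) :=
    ⟨hcd.continuousOn, fun t _ => hd0 _ (hγr t), by simp only [circleLoop_zero_eq]⟩
  have hdiv : wind (fun t => deriv f (circleLoop (c : ℂ) r t) / f (circleLoop (c : ℂ) r t)) =
      wind (fun t => deriv f (circleLoop (c : ℂ) r t)) - wind (fun t => f (circleLoop (c : ℂ) r t)) := wind_div hF' hF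
  have hWf := wind_circleLoop_eq_zeroCountC hfd hr hf0
  have hWd := wind_circleLoop_eq_zeroCountC hfd.deriv hr hd0
  have him_real : ∀ x : ℝ, (deriv f x / f x).im = 0 :=
    Summit.RiemannHypothesis.RiemannHypothesis.Theorems.UniversalFactor.im_logDeriv_ofReal hfd hreal
  -- values of `f′/f` on the circle: real non-zero at the feet, lower half-plane above the axis, upper below
  have hreal_pt : ∀ u : ℂ, ‖u - c‖ = r → u.im = 0 → (deriv f u / f u).im = 0 ∧ (deriv f u / f u).re ≠ 0 := by
    intro u hu him
    have hq : deriv f u / f u ≠ 0 := div_ne_zero (hd0 u hu) (hf0 u hu)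
    have him' : (deriv f u / f u).im = 0 := by
      rcases eq_feet_of_sphere_real hu him with e | e <;> rw [e] <;> exact him_real _
    exact ⟨him', fun hre => hq (Complex.ext (by simpa using hre) (by simpa using him'))⟩
  have hup : ∀ u : ℂ, ‖u - c‖ = r → 0 < u.im → (deriv f u / f u).im < 0 := fun u hu hpos => by
    rcases mul_neg_iff.mp (hsgn u hu hpos.ne') with h | h
    · exact h.2
    · exact absurd h.1 (not_lt.mpr hpos.le)
  have hdn : ∀ u : ℂ, ‖u - c‖ = r → u.im < 0 → 0 < (deriv f u / f u).im := fun u hu hneg => by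
    rcases mul_neg_iff.mp (hsgn u hu hneg.ne) with h | h
    · exact absurd h.1 (not_lt.mpr hneg.le)
    · exact h.2
  have hlo : ∀ t ∈ Icc (0 : ℝ) (1 / 2), I * (deriv f (circleLoop (c : ℂ) r t) / f (circleLoop (c : ℂ) r t)) ∈ slitPlane := by
    intro t ht
    rcases (circleLoop_im_nonneg (c := c) hr.le ht).eq_or_lt with h0 | hpos
    · obtain ⟨-, hre⟩ := hreal_pt _ (hγr t) h0.symm
      rw [mem_slitPlane_iff]; right
      simpa [Complex.mul_im] using hre
    · have h := hup _ (hγr t) hpos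
      rw [mem_slitPlane_iff]; left
      have e : (I * (deriv f (circleLoop (c : ℂ) r t) / f (circleLoop (c : ℂ) r t))).re =
          -(deriv f (circleLoop (c : ℂ) r t) / f (circleLoop (c : ℂ) r t)).im := by simp [Complex.mul_re]
      rw [e]; linarith
  have hhi : ∀ t ∈ Icc (1 / 2 : ℝ) 1, -I * (deriv f (circleLoop (c : ℂ) r t) / f (circleLoop (c : ℂ) r t)) ∈ slitPlane := by
    intro t ht
    rcases (circleLoop_im_nonpos (c := c) hr.le ht).eq_or_lt with h0 | hneg
    · obtain ⟨-, hre⟩ := hreal_pt _ (hγr t) h0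
      rw [mem_slitPlane_iff]; right
      simpa [Complex.mul_im] using hre
    · have h := hdn _ (hγr t) hneg
      rw [mem_slitPlane_iff]; left
      have e : (-I * (deriv f (circleLoop (c : ℂ) r t) / f (circleLoop (c : ℂ) r t))).re =
          (deriv f (circleLoop (c : ℂ) r t) / f (circleLoop (c : ℂ) r t)).im := by simp [Complex.mul_re]
      rw [e]; exact h
  have hΓc : ContinuousOn (fun t => deriv f (circleLoop (c : ℂ) r t) / f (circleLoop (c : ℂ) r t)) (Icc 0 1) :=
    hcd.continuousOn.div hcf.continuousOn fun t _ => hf0 _ (hγr t)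
  have h01 : deriv f (circleLoop (c : ℂ) r 0) / f (circleLoop (c : ℂ) r 0) =
      deriv f (circleLoop (c : ℂ) r 1) / f (circleLoop (c : ℂ) r 1) := by rw [circleLoop_zero_eq]
  have hΓ0 : (deriv f (circleLoop (c : ℂ) r 0) / f (circleLoop (c : ℂ) r 0)).im = 0 := by
    rw [circleLoop_ofReal_zero]; exact him_real _
  have hΓh : (deriv f (circleLoop (c : ℂ) r (1 / 2)) / f (circleLoop (c : ℂ) r (1 / 2))).im = 0 := by
    rw [circleLoop_ofReal_half]; exact him_real _
  have key := two_mul_wind_eq hΓc h01 hlo hhi hΓ0 hΓh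
  rw [circleLoop_ofReal_half, circleLoop_ofReal_zero, hdiv, Int.cast_sub, hWd, hWf] at key
  exact key

/-! ## §6 Disc Rolle closure -/

/-- ★ DISC ROLLE CLOSURE (twin of `…JensenWindow.no_nonreal_zero_of_rolle_core`).  Under the disc census hypotheses, if every zero of `f′`
in the open disc is real and the real Rolle identity holds on the base `(c − r, c + r)`, then every zero of `f` in the disc is real. -/
theorem no_nonreal_zero_of_disc (hfd : Differentiable ℂ f) (hreal : ∀ x : ℝ, (f x).im = 0) {c r : ℝ} (hr : 0 < r)
    (hfl : f ((c - r : ℝ) : ℂ) ≠ 0) (hfr : f ((c + r : ℝ) : ℂ) ≠ 0)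
    (hdl : deriv f ((c - r : ℝ) : ℂ) ≠ 0) (hdr : deriv f ((c + r : ℝ) : ℂ) ≠ 0)
    (hsgn : ∀ w : ℂ, ‖w - c‖ = r → w.im ≠ 0 → w.im * (deriv f w / f w).im < 0)
    (hA : ∀ ρ ∈ ball (c : ℂ) r, deriv f ρ = 0 → ρ.im = 0) (hR : RolleIdentity f (c - r) (c + r) r) :
    ∀ ρ ∈ ball (c : ℂ) r, f ρ = 0 → ρ.im = 0 := by
  classical
  have hc := disc_census hfd hreal hr hfl hfr hdl hdr hsgn
  have hf0 := ne_zero_on_sphere hfl hfr hsgn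
  have hW : SWindow f (fun _ => True) (c - r) (c + r) r :=
    ⟨by linarith, hr, fun _ _ => trivial, fun _ _ => trivial, fun _ _ _ => trivial, fun _ _ _ => trivial, hfl, hfr, hdl, hdr⟩
  set K : Set ℂ := ball (c : ℂ) r with hKdef
  have hfin : {ρ : ℂ | f ρ = 0 ∧ ρ ∈ K}.Finite := by
    refine (Rouche.finite_zeros f hr (by linarith : r < r + 1) hfd.differentiableOn hf0).subset ?_
    rintro ρ ⟨h0, hρ⟩
    exact ⟨ball_subset_closedBall hρ, h0⟩
  have e1 : {ρ : ℂ | deriv f ρ = 0 ∧ ρ ∈ K} = {ρ : ℂ | deriv f ρ = 0 ∧ ρ ∈ K ∩ {ρ | ρ.im = 0}} := by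
    ext ρ
    simp only [mem_setOf_eq, mem_inter_iff]
    constructor
    · rintro ⟨h0, hK⟩; exact ⟨h0, hK, hA ρ hK h0⟩
    · rintro ⟨h0, hK, -⟩; exact ⟨h0, hK⟩
  have e1' : zeroCountC (deriv f) K = zeroCountC (deriv f) (K ∩ {ρ | ρ.im = 0}) := by
    unfold zeroCountC; rw [e1]
  set B : Set ℂ := {ρ : ℂ | f ρ = 0 ∧ ρ ∈ K ∧ ρ.im ≠ 0} with hBdef
  have e2 : {ρ : ℂ | f ρ = 0 ∧ ρ ∈ K} = {ρ : ℂ | f ρ = 0 ∧ ρ ∈ K ∩ {ρ | ρ.im = 0}} ∪ B := by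
    ext ρ
    simp only [mem_setOf_eq, mem_inter_iff, mem_union, hBdef]
    constructor
    · rintro ⟨h0, hK⟩
      by_cases him : ρ.im = 0
      · exact Or.inl ⟨h0, hK, him⟩
      · exact Or.inr ⟨h0, hK, him⟩
    · rintro (⟨h0, hK, -⟩ | ⟨h0, hK, -⟩) <;> exact ⟨h0, hK⟩
  have hdisj : Disjoint {ρ : ℂ | f ρ = 0 ∧ ρ ∈ K ∩ {ρ | ρ.im = 0}} B := by
    rw [Set.disjoint_left]
    rintro ρ ⟨-, -, him⟩ ⟨-, -, him'⟩
    exact him' him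
  have hAfin : {ρ : ℂ | f ρ = 0 ∧ ρ ∈ K ∩ {ρ | ρ.im = 0}}.Finite := hfin.subset fun ρ hρ => ⟨hρ.1, hρ.2.1⟩
  have hBfin : B.Finite := hfin.subset fun ρ hρ => ⟨hρ.1, hρ.2.1⟩
  have e2' : zeroCountC f K = zeroCountC f (K ∩ {ρ | ρ.im = 0}) + ∑ᶠ ρ ∈ B, ((meromorphicOrderAt f ρ).untop₀ : ℂ) := by
    unfold zeroCountC; rw [e2, finsum_mem_union hdisj hAfin hBfin]
  have hB0 : ∑ᶠ ρ ∈ B, ((meromorphicOrderAt f ρ).untop₀ : ℂ) = 0 := by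
    rw [e1', e2'] at hc
    unfold RolleIdentity at hR
    rw [zeroCountC_box_real_eq, zeroCountC_box_real_eq] at hR
    linear_combination (1 / 2 : ℂ) * hR - (1 / 2 : ℂ) * hc
  rw [finsum_mem_eq_finite_toFinset_sum _ hBfin, ← Int.cast_sum] at hB0
  have hB0' : ∑ ρ ∈ hBfin.toFinset, (meromorphicOrderAt f ρ).untop₀ = 0 := by exact_mod_cast hB0
  have hpos : ∀ ρ ∈ hBfin.toFinset, 0 < (meromorphicOrderAt f ρ).untop₀ := by
    intro ρ hρ
    rw [Set.Finite.mem_toFinset] at hρ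
    exact order_pos hfd hW (ball_subset_box c r hρ.2.1) hρ.1
  have hall := (Finset.sum_eq_zero_iff_of_nonneg fun ρ hρ => (hpos ρ hρ).le).mp hB0'
  intro ρ hρK hρ0
  by_contra him
  have hρB : ρ ∈ hBfin.toFinset := by
    rw [Set.Finite.mem_toFinset]; exact ⟨hρ0, hρK, him⟩
  have h1 := hall ρ hρB
  have h2 := hpos ρ hρB
  omega

end RhW08.Lens1ArcSign
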